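import Summits.QuantumFields.YangMills.Theorems.UnitScaleTiltProp7DescentStraightCloseness
import Summits.QuantumFields.YangMills.Theorems.UnitScaleTiltProp7SPrintStraight
import Summits.QuantumFields.YangMills.Theorems.UnitScaleTiltProp7CornerFrameLegsFlatMember
import Summits.QuantumFields.YangMills.Theorems.UnitScaleTiltProp7CornerFrameLegsLetters
import Summits.QuantumFields.YangMills.Theorems.UnitScaleTiltProp7FrameResponseCombSU2T3
import HarnessLib

/-!
# `UnitScaleTiltProp7RLegsCovTop` — LANE II (R-LEGS), (K2-T): THE TOP OF THE KNIT — the route's `D̄`-averaged field `Ū_EML(ĉ)` of the coarse bond against the comb tower's top bond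
# `Ū♯ᵏ(ẑ, μ)` (`≤ Csw·e`, both within `O(e)` of the straight transport), and the coarse-bond sum of (R-LEGS-cov) re-indexed over one period cell of the level-`k` torus
# (crux `MinimiserStabilityRegPr`, stmt-QuantumFields-19200, EX lane, hN06 LANE II supplier (R-LEGS); `--supports stmt-QuantumFields-19200 --as helper`, count-neutral)

Cell `ym3-torus` (HUMAN RULING D-0037: YM₃ on T³ is ladder rung R3 — NOT d = 4, NOT infinite volume, NOT a mass gap, NOT the Clay problem), width seat `ym-ust-20520-w4` (g12), pen of the
curved row `rlegs`.  THEOREMS ONLY (0 `def`, 0 `sorry`); nothing here claims (R-LEGS-cov), (QB), (QH1), (REC), `hN06`, EX or the crux.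

THE POINT.  ✓p707999's `hCov` sums `‖r(c₋)A − Ū_EML(ĉ)·r(c₊)A·Ū_EML(ĉ)ᴴ‖²` over the coarse bonds `c` of the comparison lattice, `ĉ = bondShift c`; the legs recursion lives on `ℤ³` with the comb
tower `Ū♯ᵏ = avgIter L W♯ k` (`k = K − n`).  (i) `‖Ū_EML(ĉ) − Ū♯ᵏ(ẑ, ĉ.dir)‖ ≤ Csw·e` — ✓(B3c) `norm_iter_sub_straight_le_of_regPr` and ✓`Prop7SPrintStraight.norm_avgIter_pull_sub_straight_le` against
the SAME straight transporter (✓`coe_hol_pull_replicate`, ✓`embIter_eq_transl`); (ii) for a unit `u ∈ U1` and a unitary matrix `U`, `‖R(u)X − U·X·Uᴴ‖ ≤ 2‖u − U‖·‖X‖` (✓letters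
`norm_conjR_sub_conjR_le`); (iii) the sum over `c : PBond (F.P n) 0` IS the sum over `(z, μ) ∈ Site (F.P K) k × Fin 3` (`bondShift`, `coordT3`), the seam costing nothing for an `N_k`-periodic
`D` (✓px19 `coordT3_tgt`) ⇒ `Σ_c ‖D(c₋) − Ū_EML D(c₊) Ū_EMLᴴ‖² ≤ 2·Σ_μΣ_z ‖D(ẑ) − R(Ū♯ᵏ(ẑ,μ))D(ẑ+e_μ)‖² + 8(Csw·e)²·Σ_μΣ_z ‖D(ẑ+e_μ)‖²`.

* §1 `norm_conjR_sub_mul_mul_le` — (ii).   * §2 ★ `norm_iterEML_sub_avgIter_le_of_regPr` — (i).   * §3 ★★ `sum_coarseBond_legs_le` — (iii).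
HONEST SCOPE.  Bookkeeping at the top level; nothing analytic beyond the two cited closeness rows.  Rung R3; nothing of the crux ∕ the gap is claimed.

References: T. Bałaban, CMP 98 (1985) 17–51 [Balaban1985Averaging] ((9) p.18, (24) p.21, (43) p.24, (51)–(54) p.26, (110)–(112) p.34, (160) p.42); CMP 102 (1985) 277–309
[Balaban1985Variational] ((6) p.278, (146) p.301); CMP 109 (1987) 249–301 [Balaban1987RG1] ((0.1)–(0.4) pp.251–253).
-/

set_option autoImplicit false

noncomputable section

open scoped BigOperators Matrix.Norms.L2Operator Matrix

namespace Summit.QuantumFields.YangMills.Theorems.Prop7RLegsCovTop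

open Finset
open Literature.MathematicalPhysics.QuantumFieldTheory.Balaban1983to89
open Literature.MathematicalPhysics.QuantumFieldTheory.Balaban1983to89.T3ContinuumYM3Torus
open T4Continuum BlockAveraging AveragingRT ExpMeanLog
open T3PrintedRegularMinimiser (RegPr)
open T3LevelShift (siteShift bondShift bondShift_src bondShift_dir)
open T3PrintedRegularOrbits (sites_eq)
open T3SectALandauChart (bgUnits)
open B7Prop1Explicit renaming Site → LSite
open B7Prop1Explicit (e hol seg U1 mem_U1)
open B7Prop2Explicit (avgIter)
open B7Eq78Linearization (conjR conjR_apply)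
open B10Eq27TorusAxialLog (pull transl)
open B15DeterminingSets (embIter)
open T4TermwiseTorus (IsPeriodic)
open Summit.QuantumFields.YangMills.Theorems.Prop7SPrint (basePt)
open Summit.QuantumFields.YangMills.Theorems.Prop7SymAvgTw (coordT3 coordT3_apply)
open Summit.QuantumFields.YangMills.Theorems.Prop7AxialReprPrint (embIter_eq_transl)
open Summit.QuantumFields.YangMills.Theorems.Prop7FrameResponseCombSU2 (windows_of_ten7)
open Summit.QuantumFields.YangMills.Theorems.Prop7DescentStraightCloseness (norm_iter_sub_straight_le_of_regPr)
open Summit.QuantumFields.YangMills.Theorems.Prop7SPrintStraight (norm_avgIter_pull_sub_straight_le coe_hol_pull_replicate)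
open Summit.QuantumFields.YangMills.Theorems.Prop7CornerFrameLegsLetters (norm_conjR_sub_conjR_le)
open Summit.QuantumFields.YangMills.Theorems.Prop7CornerFrameLegsFlatMember (coordT3_tgt)

/-! ## §1 A unit conjugation against a unitary conjugation -/

section Swap

variable {𝔸 : Type*} [NormedRing 𝔸] [NormOneClass 𝔸]

/-- **`‖R(u)X − U·X·U′‖ ≤ 2‖u − U‖·‖X‖`** for `u ∈ U1` and a two-sided inverse pair `U U′ = U′ U = 1` in the unit ball (e.g. a unitary and its adjoint): the unit `⟨U, U′⟩` is in `U1` and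
✓`norm_conjR_sub_conjR_le` applies. [cite: Balaban1985Averaging, (111)–(112) p.34] -/
theorem norm_conjR_sub_mul_mul_le {u : 𝔸ˣ} (hu : u ∈ U1 𝔸) {U U' : 𝔸} (h1 : U * U' = 1) (h2 : U' * U = 1) (hU : ‖U‖ ≤ 1) (hU' : ‖U'‖ ≤ 1) (X : 𝔸) :
    ‖conjR u X - U * X * U'‖ ≤ 2 * ‖(u : 𝔸) - U‖ * ‖X‖ := by
  set v : 𝔸ˣ := ⟨U, U', h1, h2⟩ with hv
  have hvU : v ∈ U1 𝔸 := mem_U1.2 ⟨hU, hU'⟩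
  have hconj : U * X * U' = conjR v X := by rw [conjR_apply]; rfl
  rw [hconj]
  exact norm_conjR_sub_conjR_le hu hvU X

end Swap

/-! ## §2 ★ The route's `D̄`-averaged coarse bond variable against the comb tower's top bond -/

variable (F : T3Family) {n K : ℕ}

/-- ★ **`‖Ū_EML(ĉ) − Ū♯ᵏ(ẑ, ĉ.dir)‖ ≤ Csw·e`, `Csw = (5L)²∕4·(10800L+1) + 256·4·7·2`** at `RegPr F n K e W` in the window `10⁷L³e ≤ 1` (`k = K − n`, `ẑ = (ĉ.src ·).val`): both are within `O(e)` of
the straight transporter `W(x_ĉ; Lᵏ steps)` — ✓(B3c) `norm_iter_sub_straight_le_of_regPr` and ✓`norm_avgIter_pull_sub_straight_le`, the latter's `ℤ³` straight transport of the based pullback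
being the torus one (✓`coe_hol_pull_replicate`, ✓`embIter_eq_transl`). [cite: Balaban1985Averaging, (24) p.21, (43) p.24, (51)–(54) p.26; Balaban1985Variational, (6) p.278, (146) p.301;
Balaban1987RG1, (0.1) p.251, (0.4) p.253] -/
theorem norm_iterEML_sub_avgIter_le_of_regPr {e : ℝ} (he : 0 < e) (hε : 10 ^ 7 * (F.L : ℝ) ^ 3 * e ≤ 1)
    {W : GaugeField (F.P K) 0 (Matrix.specialUnitaryGroup (Fin 2) ℂ)} (hreg : RegPr F n K e W) (hnK : n ≤ K) (c : PBond (F.P K) (K - n)) :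
    ‖((Averaging.iter (fun l => blockAvg (P := F.P K) (j := l) (expMeanLogSU (n := Fin 2))) (K - n) W c : Matrix.specialUnitaryGroup (Fin 2) ℂ) :
          Matrix (Fin 2) (Fin 2) ℂ)
        - ((avgIter (F.P K).L (pull (bgUnits F K W) (basePt F n K)) (K - n) (fun ν => ((c.src ν).val : ℤ)) c.dir : (Matrix (Fin 2) (Fin 2) ℂ)ˣ) :
          Matrix (Fin 2) (Fin 2) ℂ)‖
      ≤ ((5 * (F.L : ℝ)) ^ 2 / 4 * (10800 * (F.L : ℝ) + 1) + 256 * 4 * 7 * 2) * e := by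
  have hd : (F.P K).d = 3 := rfl
  have hLL : ((F.P K).L : ℝ) = (F.L : ℝ) := rfl
  -- (a) the route's average against the straight transporter
  have hA := norm_iter_sub_straight_le_of_regPr F n K he hε hreg c
  -- (b) the comb top bond against the same transporter
  obtain ⟨hα3, hα4, -, -, -⟩ := windows_of_ten7 F (K := K) he.le hε
  have hα2 : 2 * (2 * e) ≤ B7Prop2Explicit.c2' (F.P K).d (F.P K).L := by linarith
  have hB := norm_avgIter_pull_sub_straight_le F he hα3 hα2 hreg (basePt F n K) (fun ν => ((c.src ν).val : ℤ)) c.dir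
  -- (c) the two straight transporters agree
  have hk : K - n ≤ (F.P K).m + (F.P K).K := by show K - n ≤ F.m + K; omega
  have hS : ((holAt W (walk (embIter (K - n) c.src) (List.replicate ((F.P K).L ^ (K - n)) (c.dir, true))) : Matrix.specialUnitaryGroup (Fin 2) ℂ) :
          Matrix (Fin 2) (Fin 2) ℂ)
      = ((hol (pull (bgUnits F K W) (basePt F n K)) (((F.P K).L : ℤ) ^ (K - n) • fun ν => ((c.src ν).val : ℤ)) (seg c.dir (((F.P K).L ^ (K - n) : ℕ) : ℤ)) :
          (Matrix (Fin 2) (Fin 2) ℂ)ˣ) : Matrix (Fin 2) (Fin 2) ℂ) := by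
    rw [embIter_eq_transl hk c.src]
    exact (coe_hol_pull_replicate W _ _ c.dir ((F.P K).L ^ (K - n))).symm
  rw [hS] at hA
  -- (d) triangle
  have htri := norm_sub_le_norm_sub_add_norm_sub
    ((Averaging.iter (fun l => blockAvg (P := F.P K) (j := l) (expMeanLogSU (n := Fin 2))) (K - n) W c : Matrix.specialUnitaryGroup (Fin 2) ℂ) : Matrix (Fin 2) (Fin 2) ℂ)
    ((hol (pull (bgUnits F K W) (basePt F n K)) (((F.P K).L : ℤ) ^ (K - n) • fun ν => ((c.src ν).val : ℤ)) (seg c.dir (((F.P K).L ^ (K - n) : ℕ) : ℤ)) :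
          (Matrix (Fin 2) (Fin 2) ℂ)ˣ) : Matrix (Fin 2) (Fin 2) ℂ)
    ((avgIter (F.P K).L (pull (bgUnits F K W) (basePt F n K)) (K - n) (fun ν => ((c.src ν).val : ℤ)) c.dir : (Matrix (Fin 2) (Fin 2) ℂ)ˣ) : Matrix (Fin 2) (Fin 2) ℂ)
  rw [norm_sub_rev] at hB
  refine htri.trans ((add_le_add hA hB).trans (le_of_eq ?_))
  rw [hd]; push_cast; rw [hLL]; ring

/-! ## §3 ★★ The coarse-bond sum re-indexed over one period cell of the level-`k` torus -/

section Pointwise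

variable {𝔸 : Type*} [NormedRing 𝔸] [NormOneClass 𝔸]

/-- pointwise: `‖X − U X′ U′‖² ≤ 2‖X − R(u)X′‖² + 8s²‖X′‖²` when `‖u − U‖ ≤ s` (§1 + `(a+b)² ≤ 2a² + 2b²`). [cite: Balaban1985Averaging, (111)–(112) p.34] -/
theorem sq_norm_sub_mul_mul_le {u : 𝔸ˣ} (hu : u ∈ U1 𝔸) {U U' : 𝔸} (h1 : U * U' = 1) (h2 : U' * U = 1) (hU : ‖U‖ ≤ 1) (hU' : ‖U'‖ ≤ 1) {s : ℝ} (hs0 : 0 ≤ s)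
    (hs : ‖(u : 𝔸) - U‖ ≤ s) (X X' : 𝔸) :
    ‖X - U * X' * U'‖ ^ 2 ≤ 2 * ‖X - conjR u X'‖ ^ 2 + 8 * s ^ 2 * ‖X'‖ ^ 2 := by
  have hsw : ‖conjR u X' - U * X' * U'‖ ≤ 2 * s * ‖X'‖ :=
    (norm_conjR_sub_mul_mul_le hu h1 h2 hU hU' X').trans (mul_le_mul_of_nonneg_right (mul_le_mul_of_nonneg_left hs (by norm_num)) (norm_nonneg _))
  have htri : ‖X - U * X' * U'‖ ≤ ‖X - conjR u X'‖ + 2 * s * ‖X'‖ := by linarith [norm_sub_le_norm_sub_add_norm_sub X (conjR u X') (U * X' * U')]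
  have ha0 : 0 ≤ ‖X - conjR u X'‖ := norm_nonneg _
  have hb0 : 0 ≤ 2 * s * ‖X'‖ := by positivity
  have hsq : ‖X - U * X' * U'‖ ^ 2 ≤ (‖X - conjR u X'‖ + 2 * s * ‖X'‖) ^ 2 := pow_le_pow_left₀ (norm_nonneg _) htri 2
  nlinarith [sq_nonneg (‖X - conjR u X'‖ - 2 * s * ‖X'‖)]

end Pointwise

/-- a sum over the positive bonds of a level is the sum over (direction, site). [cite: Balaban1987RG1, (0.1) p.251] -/
theorem sum_pbond_eq_sum_dir_site {P : Params} {j : ℕ} (g : PBond P j → ℝ) : ∑ b : PBond P j, g b = ∑ μ : Fin P.d, ∑ z : Site P j, g ⟨z, μ⟩ := by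
  rw [← Fintype.sum_equiv (⟨fun p => ⟨p.1, p.2⟩, fun b => (b.src, b.dir), fun _ => rfl, fun _ => rfl⟩ : (Site P j × Fin P.d) ≃ PBond P j)
    (fun p => g ⟨p.1, p.2⟩) g (fun _ => rfl), Fintype.sum_prod_type, Finset.sum_comm]

/-- the seam: for an `N_k`-periodic `D`, `D(coordT3 c₊) = D(coordT3 c₋ + e_{dir c})` (✓px19 `coordT3_tgt`). [cite: Balaban1987RG1, (0.1) p.251] -/
theorem apply_coordT3_tgt_of_periodic (hnK : n ≤ K) {β : Type*} (D : LSite (F.P K).d → β) (hDper : IsPeriodic ((F.P K).sitesPerDir (K - n)) D) (c : PBond (F.P n) 0) :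
    D (coordT3 F n K hnK c.tgt) = D (coordT3 F n K hnK c.src + e (d := (F.P K).d) c.dir) := by
  obtain ⟨w, hw, hct⟩ := coordT3_tgt (F := F) hnK c
  have hct' : coordT3 F n K hnK c.tgt = coordT3 F n K hnK c.src + e (d := (F.P K).d) c.dir - w • e (d := (F.P K).d) c.dir := hct
  rw [hct']
  rcases hw with hw0 | hwN
  · rw [hw0, zero_smul, sub_zero]
  · have hp := hDper (coordT3 F n K hnK c.src + e (d := (F.P K).d) c.dir) (-(e (d := (F.P K).d) c.dir))
    rw [hwN, sub_eq_add_neg, ← smul_neg]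
    exact hp

/-- ★★ **(K2-T) THE COARSE-BOND SUM OF (R-LEGS-cov) AGAINST THE `ℤ³` LEGS AND THE LEGS-MASS**: for `n ≤ K`, `k = K − n`, an `N_k`-periodic `D : ℤ³ → M₂`, the comb tower's top bonds in `U1` and
`‖Ū_EML(ĉ) − Ū♯ᵏ(ẑ, ĉ.dir)‖ ≤ s` for every coarse bond,
`Σ_{c : PBond (F.P n) 0} ‖D(coordT3 c₋) − Ū_EML(ĉ)·D(coordT3 c₊)·Ū_EML(ĉ)ᴴ‖² ≤ 2·Σ_μ Σ_{z : Site (F.P K) k} ‖D(ẑ) − R(Ū♯ᵏ(ẑ,μ))D(ẑ + e_μ)‖² + 8s²·Σ_μ Σ_z ‖D(ẑ + e_μ)‖²`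
(`bondShift`∕`coordT3` re-indexing, the seam by ✓`coordT3_tgt` + periodicity, §1 pointwise, `(a+b)² ≤ 2a² + 2b²`). [cite: Balaban1985Averaging, (110)–(112) p.34, (160) p.42; Balaban1987RG1, (0.1) p.251] -/
theorem sum_coarseBond_legs_le (hnK : n ≤ K) (W : GaugeField (F.P K) 0 (Matrix.specialUnitaryGroup (Fin 2) ℂ))
    (D : LSite (F.P K).d → Matrix (Fin 2) (Fin 2) ℂ) (hDper : IsPeriodic ((F.P K).sitesPerDir (K - n)) D)
    (hV : ∀ x κ, avgIter (F.P K).L (pull (bgUnits F K W) (basePt F n K)) (K - n) x κ ∈ U1 (Matrix (Fin 2) (Fin 2) ℂ)) {s : ℝ} (hs0 : 0 ≤ s)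
    (hs : ∀ c : PBond (F.P K) (K - n),
      ‖((Averaging.iter (fun l => blockAvg (P := F.P K) (j := l) (expMeanLogSU (n := Fin 2))) (K - n) W c : Matrix.specialUnitaryGroup (Fin 2) ℂ) : Matrix (Fin 2) (Fin 2) ℂ)
          - ((avgIter (F.P K).L (pull (bgUnits F K W) (basePt F n K)) (K - n) (fun ν => ((c.src ν).val : ℤ)) c.dir : (Matrix (Fin 2) (Fin 2) ℂ)ˣ) : Matrix (Fin 2) (Fin 2) ℂ)‖ ≤ s) :
    ∑ c : PBond (F.P n) 0,
        ‖D (coordT3 F n K hnK c.src)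
            - ((Averaging.iter (fun l => blockAvg (P := F.P K) (j := l) (expMeanLogSU (n := Fin 2))) (K - n) W (bondShift (sites_eq F n K hnK) c) :
                Matrix.specialUnitaryGroup (Fin 2) ℂ) : Matrix (Fin 2) (Fin 2) ℂ)
              * D (coordT3 F n K hnK c.tgt)
              * star ((Averaging.iter (fun l => blockAvg (P := F.P K) (j := l) (expMeanLogSU (n := Fin 2))) (K - n) W (bondShift (sites_eq F n K hnK) c) :
                Matrix.specialUnitaryGroup (Fin 2) ℂ) : Matrix (Fin 2) (Fin 2) ℂ)‖ ^ 2
      ≤ 2 * ∑ μ : Fin (F.P K).d, ∑ z : Site (F.P K) (K - n),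
            ‖D (fun ν => ((z ν).val : ℤ)) - conjR (avgIter (F.P K).L (pull (bgUnits F K W) (basePt F n K)) (K - n) (fun ν => ((z ν).val : ℤ)) μ) (D ((fun ν => ((z ν).val : ℤ)) + e μ))‖ ^ 2
        + 8 * s ^ 2 * ∑ μ : Fin (F.P K).d, ∑ z : Site (F.P K) (K - n), ‖D ((fun ν => ((z ν).val : ℤ)) + e μ)‖ ^ 2 := by
  classical
  -- the summand as a function of the level-`k` bond `ĉ`
  set g : PBond (F.P K) (K - n) → ℝ := fun c' =>
    ‖D (fun ν => ((c'.src ν).val : ℤ))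
        - ((Averaging.iter (fun l => blockAvg (P := F.P K) (j := l) (expMeanLogSU (n := Fin 2))) (K - n) W c' : Matrix.specialUnitaryGroup (Fin 2) ℂ) : Matrix (Fin 2) (Fin 2) ℂ)
          * D ((fun ν => ((c'.src ν).val : ℤ)) + e c'.dir)
          * star ((Averaging.iter (fun l => blockAvg (P := F.P K) (j := l) (expMeanLogSU (n := Fin 2))) (K - n) W c' : Matrix.specialUnitaryGroup (Fin 2) ℂ) :
            Matrix (Fin 2) (Fin 2) ℂ)‖ ^ 2 with hg
  -- (1) re-index `c ↦ ĉ = bondShift c` (`coordT3 c₋ = ẑ`, the seam by periodicity)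
  have hre : ∀ c : PBond (F.P n) 0,
      ‖D (coordT3 F n K hnK c.src)
          - ((Averaging.iter (fun l => blockAvg (P := F.P K) (j := l) (expMeanLogSU (n := Fin 2))) (K - n) W (bondShift (sites_eq F n K hnK) c) :
              Matrix.specialUnitaryGroup (Fin 2) ℂ) : Matrix (Fin 2) (Fin 2) ℂ)
            * D (coordT3 F n K hnK c.tgt)
            * star ((Averaging.iter (fun l => blockAvg (P := F.P K) (j := l) (expMeanLogSU (n := Fin 2))) (K - n) W (bondShift (sites_eq F n K hnK) c) :
              Matrix.specialUnitaryGroup (Fin 2) ℂ) : Matrix (Fin 2) (Fin 2) ℂ)‖ ^ 2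
        = g (bondShift (sites_eq F n K hnK) c) := by
    intro c
    rw [apply_coordT3_tgt_of_periodic F hnK D hDper c]
    rfl
  rw [Finset.sum_congr rfl fun c _ => hre c]
  refine (Fintype.sum_equiv (bondShift (sites_eq F n K hnK)) _ g (fun c => rfl)).trans_le ?_
  refine (sum_pbond_eq_sum_dir_site g).trans_le ?_
  rw [Finset.mul_sum, Finset.mul_sum, ← Finset.sum_add_distrib]
  refine Finset.sum_le_sum fun μ _ => ?_
  rw [Finset.mul_sum, Finset.mul_sum, ← Finset.sum_add_distrib]
  refine Finset.sum_le_sum fun z _ => ?_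
  -- (2) pointwise
  have hUu : ((Averaging.iter (fun l => blockAvg (P := F.P K) (j := l) (expMeanLogSU (n := Fin 2))) (K - n) W ⟨z, μ⟩ : Matrix.specialUnitaryGroup (Fin 2) ℂ) :
      Matrix (Fin 2) (Fin 2) ℂ) ∈ Matrix.unitaryGroup (Fin 2) ℂ :=
    (Matrix.mem_specialUnitaryGroup_iff.1 (Averaging.iter (fun l => blockAvg (P := F.P K) (j := l) (expMeanLogSU (n := Fin 2))) (K - n) W ⟨z, μ⟩).2).1
  have hn1 := (CStarRing.norm_of_mem_unitary hUu).le
  exact sq_norm_sub_mul_mul_le (hV _ μ) (Unitary.mul_star_self_of_mem hUu) (Unitary.star_mul_self_of_mem hUu) hn1 (by rw [norm_star]; exact hn1) hs0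
    (by have h := hs ⟨z, μ⟩; rwa [norm_sub_rev] at h) _ _

end Summit.QuantumFields.YangMills.Theorems.Prop7RLegsCovTop

end
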